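import Summits.HubbardSuperconductivity.HubbardSuperconductivity.Theorems.KLProgrammeKLRegimeScaleZeroTadpoleNonvanishingAtClosers
import Summits.HubbardSuperconductivity.HubbardSuperconductivity.Theorems.KLProgrammeKLRegimeScaleZeroTwoLegTail3Numeral

/-!
# Route `KLProgramme`, crux K3 — ENGINE (stmt-HubbardSuperconductivity-20437), row (C) `stub_twoLeg_curvature`, the SCALE-0 PRIVATE PAIR of `hres′`
# (…ClosersCGQGuardInst l.197–200) FROM THE RECORD ROWS ONLY, part 1/3: RAW TABLES — every analytic row of `twoLegRead_frameZero_of_sunsetData` discharged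

Seat hubbard-kl-k3c5-p1 (g20; lineage owner of #22a).  The (C) closer's residual package `hres′` asks, at scale `0`,
`TwoLegReadJetBound L M cc cc′ β U μ (K₀) 0 ∧ TwoLegReadOscAt L M x₀ β U μ (K₀) 0` with private tables dominated by `klC4aJetC2 / klC4aJetC′ P R / klReadOscC P R`.
The assembly `twoLegRead_frameZero_of_sunsetData` (✓ p625015) produces that pair from ELEVEN hypothesis families; this file discharges, under
`μ ∈ klWindowC`, `0 < U ≤ klTailBookU` (⇐ `U ≤ klEngU₀12GQ …`, ✓ `klEngU₀12GQ_le_klTailBookU`), `klBetaMin ≤ β`, `klEngL₃ β U ≤ L`, `klEngM₃ β U L ≤ M`, every family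
that is ANALYTIC in the tree:
* `hTon` / `hToff k` (k ≤ 4): p1 g21's «A-SIZES-WEIGHTED» numeral tail rows `twoLeg_wsum/offDiag_moment_pow_sum_tail3_frameZero_le_booked_numeral` at `Ub := klTailBookU = 10⁻³⁰⁰`
  (`tv = S·Ub²`, `tb k = 2ᵏ·S·Ub`, `S = 2¹³e²⁷46³10¹⁹⁰`);
* `hSall` and `hS0` (plain / off-site sunset column): `sunset_plainSum_le_of_col ∘ colSum_scaleZero_le_A0` at the bare frame, `bSA = bS₀ = 256·klScaleZeroA0`;
* `hγ` (free curve `C⁴`): `freeFermiPointLp_C4`;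
* `hA` (chain aliasing, `Mdeg = 12`): **`alias_le_of_le_four`** — every entry `j ≤ 4` of the majorant is `≤ 10⁹⁸U⁸·U²` (`aliasZero_le`'s arithmetic at `(12!)²`, `(16·351233)¹²`,
  `(2/N)^{8−j} ≤ (2/N)⁴ ≤ (U²/2⁸)⁴`), so `a j := 10⁹⁸·U⁸`.
What is NOT analytic stays a hypothesis, in the assembly's own currency: the CERTIFIED Euclidean sunset moments `hS12` (k = 1, 2; #22a, readers ✓ p715778/p720917),
the sunset's on-curve jets `hSjet` (k = 3, 4; #22b), and the free Fermi-point sizes `hD` (`D 1 … D 4`).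
* **`twoLegRead_frameZero_raw_of_records`** — the assembly's pair at these analytic tables (part 2 `…ScaleZeroRecordPairTables` bounds them by clean private tables,
  part 3 `…ScaleZeroRecordPairRegistered` gives the private / REGISTERED pair and the (C) closer's prefix form).
Proofs only; no definitions; nothing here asserts (C), any stub of 20437, K3 or superconductivity; the record rows are HYPOTHESES (kit records, FROZEN).
References: BGM 2006 §2.3–§2.4 (2.36)–(2.42), §3 (3.2)–(3.3) [cite: BenfattoGiulianiMastropietro2006].
-/

noncomputable section

namespace Summit.HubbardSuperconductivity.HubbardSuperconductivity.Theorems.KLRegimeSplit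

set_option linter.dupNamespace false -- summit = problem name (single-conjunct summit), D-0017
set_option exponentiation.threshold 4096 -- `klTailBookU = 10⁻³⁰⁰` bookkeeping

open Real Finset Complex Literature.MathematicalPhysics.QuantumLattice Literature.Probability.LatticeModels GrassmannAlgebra Matrix
open Literature.MathematicalPhysics.QuantumLattice.FermiRG Literature.Probability.LatticeModels.BattleFederbush
open Summit.HubbardSuperconductivity.HubbardSuperconductivity.Theorems.KLProgrammeLegKernels
open Summit.HubbardSuperconductivity.HubbardSuperconductivity.Theorems.TwoLegFourier
open Summit.HubbardSuperconductivity.HubbardSuperconductivity.Theorems.EngineV8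
open Summit.HubbardSuperconductivity.HubbardSuperconductivity.Theorems.PerturbedFermiCurve
open Summit.HubbardSuperconductivity.HubbardSuperconductivity.Theorems.DispersionFlow
open Summit.HubbardSuperconductivity.HubbardSuperconductivity.Theorems.C4a (bell4)
open scoped Nat

/-! ## §1 The chain's aliasing majorants at `Mdeg = 12`, every entry `j ≤ 4` -/

section Alias

variable {L M : ℕ} [NeZero L] [NeZero M] {μ U β : ℝ}

/-- **Every entry `j ≤ 4` of the chain's aliasing majorant at `Mdeg = 12` is `≤ 10⁹⁸·U¹⁰` on the regime**: `‖κ‖·8|βL²|·(2/klE0) ≤ 2¹³U²`, `3ʲ ≤ 81`,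
`(12!)² = 229442532802560000`, `(16·351233)¹² ≤ 10⁸¹`, `(2/N)^{12−j−4} ≤ (2/N)⁴ ≤ (U²/2⁸)⁴` (`L ≥ klEngL₃ ≥ 2¹⁰U⁻²`), `2²C₂ ≤ 81`.
[cite: BenfattoGiulianiMastropietro2006, §2.4] -/
theorem alias_le_of_le_four {β : ℝ} (hβ : klBetaMin ≤ β) (hU : 0 < U) (hL : klEngL₃ β U ≤ L) (μ : ℝ) {j : ℕ} (hj : j ≤ 4) :
    2 * ((3 : ℝ) ^ j *
      (‖(-(((U * (β / (2 * (2 * M) : ℕ)) : ℝ) : ℂ) ^ 2 *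
              ((-∑ k : FreqMomentum L M, ((1 / (β * (L : ℝ) ^ 2) : ℝ) : ℂ) ^ 2 * uvSymbolCT L M β μ 0 klE0 (k, 0)) *
               (-∑ k : FreqMomentum L M, ((1 / (β * (L : ℝ) ^ 2) : ℝ) : ℂ) ^ 2 * uvSymbolCT L M β μ 0 klE0 (k, 0)))) * ((((2 * (2 * M) : ℕ) : ℂ) ^ 2 / (β ^ 3 * (L : ℝ) ^ 2 : ℝ)) : ℂ))‖ *
        (8 * (|β * (L : ℝ) ^ 2| * (2 / klE0)) * ((12 ! : ℝ)) ^ 2 * (4 * 4 * (1 + 2 * (16 * (1 + 342) / klE0))) ^ 12)) *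
      (2 / ((2 * (L / 4 + 1) : ℕ) : ℝ)) ^ (12 - j - 4) * (2 ^ 2 * ∑' k : Fin 2 → ℤ, ∏ i, (1 + (k i : ℝ) ^ 2)⁻¹)) ≤ ((10 : ℝ) ^ 98 * U ^ 8) * U ^ 2 := by
  have hβ0 : 0 < β := lt_of_lt_of_le (by norm_num [klBetaMin]) hβ
  have hLnat : 1 ≤ L := Nat.pos_of_ne_zero (NeZero.ne L)
  have hLpos : (0 : ℝ) < L := by exact_mod_cast hLnat
  have hN : (0 : ℝ) < ((2 * (2 * M) : ℕ) : ℝ) := by have := NeZero.ne M; positivity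
  -- `L ≥ 2¹⁰/U²`
  have hLU : (2 : ℝ) ^ 10 / U ^ 2 ≤ (L : ℝ) := by
    unfold klEngL₃ at hL
    have hcast : ((2 ^ 10 * (⌈|β|⌉₊ + 1) ^ 2 * (⌈|U|⁻¹⌉₊ + 1) ^ 2 : ℕ) : ℝ) ≤ (L : ℝ) := by exact_mod_cast hL
    push_cast at hcast
    rw [abs_of_pos hU] at hcast
    have hu : U⁻¹ ≤ (⌈U⁻¹⌉₊ : ℝ) + 1 := by
      have h1 : U⁻¹ ≤ (⌈U⁻¹⌉₊ : ℝ) := Nat.le_ceil _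
      linarith
    have hu2 : U⁻¹ ^ 2 ≤ ((⌈U⁻¹⌉₊ : ℝ) + 1) ^ 2 := pow_le_pow_left₀ (by positivity) hu 2
    have hb : (1 : ℝ) ≤ ((⌈|β|⌉₊ : ℝ) + 1) ^ 2 := by
      have : (0 : ℝ) ≤ (⌈|β|⌉₊ : ℝ) := Nat.cast_nonneg _
      nlinarith
    have heq : (2 : ℝ) ^ 10 / U ^ 2 = 2 ^ 10 * 1 * U⁻¹ ^ 2 := by rw [inv_pow]; field_simp
    rw [heq]
    have h0 : (0 : ℝ) ≤ U⁻¹ ^ 2 := by positivity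
    calc (2 : ℝ) ^ 10 * 1 * U⁻¹ ^ 2 ≤ (2 : ℝ) ^ 10 * ((⌈|β|⌉₊ : ℝ) + 1) ^ 2 * ((⌈U⁻¹⌉₊ : ℝ) + 1) ^ 2 :=
          mul_le_mul (mul_le_mul_of_nonneg_left hb (by norm_num)) hu2 h0 (by positivity)
      _ ≤ (L : ℝ) := by have h' := hcast; norm_num at h' ⊢; exact h'
  -- `2/N ≤ 4/L ≤ U²/2⁸`, and `2/N ≤ 1`
  have hN' : (L : ℝ) / 2 ≤ ((2 * (L / 4 + 1) : ℕ) : ℝ) := by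
    have h : L ≤ 2 * (2 * (L / 4 + 1)) := by omega
    have h' : (L : ℝ) ≤ 2 * ((2 * (L / 4 + 1) : ℕ) : ℝ) := by exact_mod_cast h
    linarith
  have hN'pos : (0 : ℝ) < ((2 * (L / 4 + 1) : ℕ) : ℝ) := by positivity
  have hrN : 2 / ((2 * (L / 4 + 1) : ℕ) : ℝ) ≤ U ^ 2 / 2 ^ 8 := by
    rw [div_le_iff₀ hN'pos]
    have h1 : U ^ 2 * (L : ℝ) ≥ 2 ^ 10 := by
      have := (div_le_iff₀ (by positivity : (0:ℝ) < U ^ 2)).1 hLU; linarith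
    nlinarith
  have hrN0 : 0 ≤ 2 / ((2 * (L / 4 + 1) : ℕ) : ℝ) := by positivity
  have hrN1 : 2 / ((2 * (L / 4 + 1) : ℕ) : ℝ) ≤ 1 := by
    rw [div_le_one hN'pos]
    have h2 : (2 : ℕ) ≤ 2 * (L / 4 + 1) := by omega
    exact_mod_cast h2
  have hr4 : (2 / ((2 * (L / 4 + 1) : ℕ) : ℝ)) ^ (12 - j - 4) ≤ (U ^ 2 / 2 ^ 8) ^ 4 := by
    have hexp : 4 ≤ 12 - j - 4 := by omega
    calc (2 / ((2 * (L / 4 + 1) : ℕ) : ℝ)) ^ (12 - j - 4) ≤ (2 / ((2 * (L / 4 + 1) : ℕ) : ℝ)) ^ 4 :=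
          pow_le_pow_of_le_one hrN0 hrN1 hexp
      _ ≤ (U ^ 2 / 2 ^ 8) ^ 4 := pow_le_pow_left₀ hrN0 hrN 4
  have h3j : (3 : ℝ) ^ j ≤ 81 := by
    calc (3 : ℝ) ^ j ≤ (3 : ℝ) ^ 4 := pow_le_pow_right₀ (by norm_num) hj
      _ = 81 := by norm_num
  -- `‖κ‖·8|βL²|(2/klE0) ≤ 2¹³·U²`
  have hT : ‖(-∑ k : FreqMomentum L M, ((1 / (β * (L : ℝ) ^ 2) : ℝ) : ℂ) ^ 2 * uvSymbolCT L M β μ 0 klE0 (k, 0))‖ ≤ 4 := by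
    rw [norm_neg]; exact norm_scaleZero_tadpole_le_four hβ0 μ 0
  have hκ : ‖(-(((U * (β / (2 * (2 * M) : ℕ)) : ℝ) : ℂ) ^ 2 *
              ((-∑ k : FreqMomentum L M, ((1 / (β * (L : ℝ) ^ 2) : ℝ) : ℂ) ^ 2 * uvSymbolCT L M β μ 0 klE0 (k, 0)) *
               (-∑ k : FreqMomentum L M, ((1 / (β * (L : ℝ) ^ 2) : ℝ) : ℂ) ^ 2 * uvSymbolCT L M β μ 0 klE0 (k, 0)))) * ((((2 * (2 * M) : ℕ) : ℂ) ^ 2 / (β ^ 3 * (L : ℝ) ^ 2 : ℝ)) : ℂ))‖ *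
      (8 * (|β * (L : ℝ) ^ 2| * (2 / klE0))) ≤ 2 ^ 13 * U ^ 2 := by
    have hUE : ‖((U * (β / (2 * (2 * M) : ℕ)) : ℝ) : ℂ)‖ = U * (β / ((2 * (2 * M) : ℕ) : ℝ)) := by
      rw [Complex.norm_real, Real.norm_eq_abs, abs_of_pos (by positivity)]
    have hX : ‖((((2 * (2 * M) : ℕ) : ℂ) ^ 2 / (β ^ 3 * (L : ℝ) ^ 2 : ℝ)) : ℂ)‖ = ((2 * (2 * M) : ℕ) : ℝ) ^ 2 / (β ^ 3 * (L : ℝ) ^ 2) := by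
      rw [norm_div, norm_pow, Complex.norm_natCast, Complex.norm_real, Real.norm_eq_abs, abs_of_pos (by positivity)]
    rw [norm_mul, norm_neg, norm_mul, norm_pow, hUE, norm_mul, hX, abs_of_pos (by positivity : (0:ℝ) < β * (L : ℝ) ^ 2),
      show klE0 = 1 / 32 from rfl]
    have hT2 : ‖(-∑ k : FreqMomentum L M, ((1 / (β * (L : ℝ) ^ 2) : ℝ) : ℂ) ^ 2 * uvSymbolCT L M β μ 0 klE0 (k, 0))‖ *
        ‖(-∑ k : FreqMomentum L M, ((1 / (β * (L : ℝ) ^ 2) : ℝ) : ℂ) ^ 2 * uvSymbolCT L M β μ 0 klE0 (k, 0))‖ ≤ 16 := by nlinarith [norm_nonneg (-∑ k : FreqMomentum L M, ((1 / (β * (L : ℝ) ^ 2) : ℝ) : ℂ) ^ 2 * uvSymbolCT L M β μ 0 klE0 (k, 0))]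
    have hkey : (U * (β / ((2 * (2 * M) : ℕ) : ℝ))) ^ 2 * (((2 * (2 * M) : ℕ) : ℝ) ^ 2 / (β ^ 3 * (L : ℝ) ^ 2)) *
        (8 * (β * (L : ℝ) ^ 2 * (2 / (1 / 32)))) = 2 ^ 9 * U ^ 2 := by
      field_simp; ring
    calc (U * (β / ((2 * (2 * M) : ℕ) : ℝ))) ^ 2 * (‖(-∑ k : FreqMomentum L M, ((1 / (β * (L : ℝ) ^ 2) : ℝ) : ℂ) ^ 2 * uvSymbolCT L M β μ 0 klE0 (k, 0))‖ *
          ‖(-∑ k : FreqMomentum L M, ((1 / (β * (L : ℝ) ^ 2) : ℝ) : ℂ) ^ 2 * uvSymbolCT L M β μ 0 klE0 (k, 0))‖) * (((2 * (2 * M) : ℕ) : ℝ) ^ 2 / (β ^ 3 * (L : ℝ) ^ 2)) * (8 * (β * (L : ℝ) ^ 2 * (2 / (1 / 32))))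
        = (‖(-∑ k : FreqMomentum L M, ((1 / (β * (L : ℝ) ^ 2) : ℝ) : ℂ) ^ 2 * uvSymbolCT L M β μ 0 klE0 (k, 0))‖ *
          ‖(-∑ k : FreqMomentum L M, ((1 / (β * (L : ℝ) ^ 2) : ℝ) : ℂ) ^ 2 * uvSymbolCT L M β μ 0 klE0 (k, 0))‖) * ((U * (β / ((2 * (2 * M) : ℕ) : ℝ))) ^ 2 * (((2 * (2 * M) : ℕ) : ℝ) ^ 2 / (β ^ 3 * (L : ℝ) ^ 2)) *
            (8 * (β * (L : ℝ) ^ 2 * (2 / (1 / 32))))) := by ring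
      _ ≤ 16 * (2 ^ 9 * U ^ 2) := by rw [hkey]; exact mul_le_mul_of_nonneg_right hT2 (by positivity)
      _ = 2 ^ 13 * U ^ 2 := by ring
  have hC₂ := Literature.Analysis.FunctionSpaces.Torus.tsum_prod_inv_one_add_sq_fin_two_le
  have hC₂0 : 0 ≤ ∑' k : Fin 2 → ℤ, ∏ i, (1 + (k i : ℝ) ^ 2)⁻¹ := tsum_nonneg fun k => prod_nonneg fun i _ => by positivity
  have hfac : ((12 ! : ℝ)) ^ 2 = 229442532802560000 := by norm_num [Nat.factorial]
  have hcst : (4 * 4 * (1 + 2 * (16 * (1 + 342) / klE0)) : ℝ) ^ 12 ≤ (10 : ℝ) ^ 81 := by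
    rw [show klE0 = 1 / 32 from rfl]; norm_num
  have hκ0 : 0 ≤ ‖(-(((U * (β / (2 * (2 * M) : ℕ)) : ℝ) : ℂ) ^ 2 *
              ((-∑ k : FreqMomentum L M, ((1 / (β * (L : ℝ) ^ 2) : ℝ) : ℂ) ^ 2 * uvSymbolCT L M β μ 0 klE0 (k, 0)) *
               (-∑ k : FreqMomentum L M, ((1 / (β * (L : ℝ) ^ 2) : ℝ) : ℂ) ^ 2 * uvSymbolCT L M β μ 0 klE0 (k, 0)))) * ((((2 * (2 * M) : ℕ) : ℂ) ^ 2 / (β ^ 3 * (L : ℝ) ^ 2 : ℝ)) : ℂ))‖ *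
      (8 * (|β * (L : ℝ) ^ 2| * (2 / klE0))) := mul_nonneg (norm_nonneg _) (by rw [show klE0 = 1 / 32 from rfl]; positivity)
  -- assemble
  have hU2 : 0 ≤ U ^ 2 := sq_nonneg U
  calc 2 * ((3 : ℝ) ^ j *
      (‖(-(((U * (β / (2 * (2 * M) : ℕ)) : ℝ) : ℂ) ^ 2 *
              ((-∑ k : FreqMomentum L M, ((1 / (β * (L : ℝ) ^ 2) : ℝ) : ℂ) ^ 2 * uvSymbolCT L M β μ 0 klE0 (k, 0)) *
               (-∑ k : FreqMomentum L M, ((1 / (β * (L : ℝ) ^ 2) : ℝ) : ℂ) ^ 2 * uvSymbolCT L M β μ 0 klE0 (k, 0)))) * ((((2 * (2 * M) : ℕ) : ℂ) ^ 2 / (β ^ 3 * (L : ℝ) ^ 2 : ℝ)) : ℂ))‖ *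
        (8 * (|β * (L : ℝ) ^ 2| * (2 / klE0)) * ((12 ! : ℝ)) ^ 2 * (4 * 4 * (1 + 2 * (16 * (1 + 342) / klE0))) ^ 12)) *
      (2 / ((2 * (L / 4 + 1) : ℕ) : ℝ)) ^ (12 - j - 4) * (2 ^ 2 * ∑' k : Fin 2 → ℤ, ∏ i, (1 + (k i : ℝ) ^ 2)⁻¹))
      = 2 * ((3 : ℝ) ^ j * ((‖(-(((U * (β / (2 * (2 * M) : ℕ)) : ℝ) : ℂ) ^ 2 *
              ((-∑ k : FreqMomentum L M, ((1 / (β * (L : ℝ) ^ 2) : ℝ) : ℂ) ^ 2 * uvSymbolCT L M β μ 0 klE0 (k, 0)) *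
               (-∑ k : FreqMomentum L M, ((1 / (β * (L : ℝ) ^ 2) : ℝ) : ℂ) ^ 2 * uvSymbolCT L M β μ 0 klE0 (k, 0)))) * ((((2 * (2 * M) : ℕ) : ℂ) ^ 2 / (β ^ 3 * (L : ℝ) ^ 2 : ℝ)) : ℂ))‖ *
          (8 * (|β * (L : ℝ) ^ 2| * (2 / klE0)))) * (((12 ! : ℝ)) ^ 2 * (4 * 4 * (1 + 2 * (16 * (1 + 342) / klE0))) ^ 12))) *
        (2 / ((2 * (L / 4 + 1) : ℕ) : ℝ)) ^ (12 - j - 4) * (2 ^ 2 * ∑' k : Fin 2 → ℤ, ∏ i, (1 + (k i : ℝ) ^ 2)⁻¹) := by ring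
    _ ≤ 2 * (81 * ((2 ^ 13 * U ^ 2) * (229442532802560000 * (10 : ℝ) ^ 81))) * (U ^ 2 / 2 ^ 8) ^ 4 * (2 ^ 2 * (81 / 4)) := by
        rw [← hfac]
        gcongr
    _ ≤ (10 : ℝ) ^ 98 * U ^ 10 := by nlinarith [pow_nonneg hU2 5]
    _ = ((10 : ℝ) ^ 98 * U ^ 8) * U ^ 2 := by ring

end Alias

/-! ## §2 The scale-`0` pair from the record rows, RAW tables: tail, plain sunset column, curve regularity and aliasing DISCHARGED -/

section Raw

variable {L M : ℕ} [NeZero L] [NeZero M] {μ U β : ℝ}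

omit [NeZero M] in
/-- The off-site indicator row of the sunset is below its plain column (`[x⃗₁ ≠ x⃗₀] ≤ 1`). -/
theorem sunset_offSiteSum_le_plainSum (β μ : ℝ) (σ : Fin 2) (p₀ : GridPoint L (2 * (2 * M))) :
    ∑ p₁ : GridPoint L (2 * (2 * M)),
      (if p₁ = p₀ then (0 : ℝ) else (if p₁.2 - p₀.2 = 0 then (0 : ℝ) else 1) * ‖contr ℂ ((hubbardGridSub L M β (2 * (2 * M))).transpose * hubbardCovAboveCT L M β μ 0 0 klE0 *
                hubbardGridSub L M β (2 * (2 * M))) (((p₁, σ), 0) : GridLeg (GridPoint L (2 * (2 * M)))) ((p₀, σ), 1) *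
              (contr ℂ ((hubbardGridSub L M β (2 * (2 * M))).transpose * hubbardCovAboveCT L M β μ 0 0 klE0 *
                hubbardGridSub L M β (2 * (2 * M))) (((p₀, σ.rev), 0) : GridLeg (GridPoint L (2 * (2 * M)))) ((p₁, σ.rev), 1) *
                contr ℂ ((hubbardGridSub L M β (2 * (2 * M))).transpose * hubbardCovAboveCT L M β μ 0 0 klE0 *
                hubbardGridSub L M β (2 * (2 * M))) (((p₁, σ.rev), 0) : GridLeg (GridPoint L (2 * (2 * M)))) ((p₀, σ.rev), 1))‖) ≤
    ∑ p₁ : GridPoint L (2 * (2 * M)), (if p₁ = p₀ then (0 : ℝ) else (1 : ℝ) * ‖contr ℂ ((hubbardGridSub L M β (2 * (2 * M))).transpose * hubbardCovAboveCT L M β μ 0 0 klE0 *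
                hubbardGridSub L M β (2 * (2 * M))) (((p₁, σ), 0) : GridLeg (GridPoint L (2 * (2 * M)))) ((p₀, σ), 1) *
              (contr ℂ ((hubbardGridSub L M β (2 * (2 * M))).transpose * hubbardCovAboveCT L M β μ 0 0 klE0 *
                hubbardGridSub L M β (2 * (2 * M))) (((p₀, σ.rev), 0) : GridLeg (GridPoint L (2 * (2 * M)))) ((p₁, σ.rev), 1) *
                contr ℂ ((hubbardGridSub L M β (2 * (2 * M))).transpose * hubbardCovAboveCT L M β μ 0 0 klE0 *
                hubbardGridSub L M β (2 * (2 * M))) (((p₁, σ.rev), 0) : GridLeg (GridPoint L (2 * (2 * M)))) ((p₀, σ.rev), 1))‖) := by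
  refine Finset.sum_le_sum fun p₁ _ => ?_
  split_ifs <;> first | exact le_rfl | (rw [zero_mul]; positivity)

/-- `klTailBookU = 10⁻³⁰⁰ ≤ 10⁻¹⁰³` (the numeral tail rows' coupling ceiling). -/
theorem klTailBookU_le_inv_ten_pow_103 : klTailBookU ≤ 1 / (10 : ℝ) ^ 103 := by
  unfold klTailBookU
  exact one_div_le_one_div_of_le (by positivity) (pow_le_pow_right₀ (by norm_num) (by norm_num))

set_option maxRecDepth 8192 in
set_option maxHeartbeats 800000 in -- one instantiation of the eleven-family assembly with written-out grid rows
/-- **THE SCALE-0 PAIR OF `hres′` FROM THE RECORD ROWS, RAW TABLES** (`twoLegRead_frameZero_of_sunsetData` with every analytic family discharged): on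
`μ ∈ klWindowC`, `0 < U ≤ klTailBookU`, `klBetaMin ≤ β`, `klEngL₃ β U ≤ L`, `klEngM₃ β U L ≤ M`, from the CERTIFIED Euclidean sunset moments `hS12` (k = 1, 2; #22a),
the sunset's on-curve jets `hSjet` (k = 3, 4; #22b) and the free Fermi-point sizes `hD`, the assembly's pair at `tv = S·Ub²`, `tb k = 2ᵏ·S·Ub`, `bSA = bS₀ = 256·klScaleZeroA0`,
`a j = 10⁹⁸U⁸` (`S = 2¹³e²⁷46³10¹⁹⁰`, `Ub = klTailBookU`). [cite: BenfattoGiulianiMastropietro2006, §2.4 (2.36)-(2.42)] -/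
theorem twoLegRead_frameZero_raw_of_records (hβ : klBetaMin ≤ β) (hμ : μ ∈ klWindowC) (hU : 0 < U) (hUb : U ≤ klTailBookU)
    (hL : klEngL₃ β U ≤ L) (hM : klEngM₃ β U L ≤ M) {bS sS D : ℕ → ℝ}
    (hS12 : ∀ k, 1 ≤ k → k ≤ 2 → ∀ (σ : Fin 2) (p₀ : GridPoint L (2 * (2 * M))), ∑ p₁ : GridPoint L (2 * (2 * M)),
      (if p₁ = p₀ then (0 : ℝ) else
        Real.sqrt ((((p₁.2 - p₀.2) 0).valMinAbs.natAbs : ℝ) ^ 2 + (((p₁.2 - p₀.2) 1).valMinAbs.natAbs : ℝ) ^ 2) ^ k * ‖contr ℂ ((hubbardGridSub L M β (2 * (2 * M))).transpose * hubbardCovAboveCT L M β μ 0 0 klE0 *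
                hubbardGridSub L M β (2 * (2 * M))) (((p₁, σ), 0) : GridLeg (GridPoint L (2 * (2 * M)))) ((p₀, σ), 1) *
              (contr ℂ ((hubbardGridSub L M β (2 * (2 * M))).transpose * hubbardCovAboveCT L M β μ 0 0 klE0 *
                hubbardGridSub L M β (2 * (2 * M))) (((p₀, σ.rev), 0) : GridLeg (GridPoint L (2 * (2 * M)))) ((p₁, σ.rev), 1) *
                contr ℂ ((hubbardGridSub L M β (2 * (2 * M))).transpose * hubbardCovAboveCT L M β μ 0 0 klE0 *
                hubbardGridSub L M β (2 * (2 * M))) (((p₁, σ.rev), 0) : GridLeg (GridPoint L (2 * (2 * M)))) ((p₀, σ.rev), 1))‖) ≤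
        bS k * (((2 * (2 * M) : ℕ) : ℝ) / β))
    (hSjet : ∀ k, 3 ≤ k → k ≤ 4 → ∀ θ : ℝ, |iteratedDeriv k (fun θ : ℝ => evalM (symInterp L (fun pp : TorusSite 2 L =>
        (∑ σσ : Fin 2, ((selfEnergy L M β (ExteriorAlgebra.map (Matrix.toLin' (gridSubMatrix L M β
            (fun p : GridPoint L (2 * (2 * M)) => p.2) (fun p => gridTime β (2 * (2 * M)) p.1)))
          (∑ p' : GridPoint L (2 * (2 * M)), ∑ q' : GridPoint L (2 * (2 * M)), ∑ σ' : Fin 2,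
          (if p' = q' then (0 : ℂ) else
            -((((U * (β / (2 * (2 * M) : ℕ)) : ℝ) : ℂ) ^ 2 *
              (contr ℂ ((hubbardGridSub L M β (2 * (2 * M))).transpose * hubbardCovAboveCT L M β μ 0 0 klE0 *
                  hubbardGridSub L M β (2 * (2 * M))) (((q', σ'), 0) : GridLeg (GridPoint L (2 * (2 * M)))) ((p', σ'), 1) *
                (contr ℂ ((hubbardGridSub L M β (2 * (2 * M))).transpose * hubbardCovAboveCT L M β μ 0 0 klE0 *
                    hubbardGridSub L M β (2 * (2 * M))) (((p', σ'.rev), 0) : GridLeg (GridPoint L (2 * (2 * M)))) ((q', σ'.rev), 1) *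
                  contr ℂ ((hubbardGridSub L M β (2 * (2 * M))).transpose * hubbardCovAboveCT L M β μ 0 0 klE0 *
                    hubbardGridSub L M β (2 * (2 * M))) (((q', σ'.rev), 0) : GridLeg (GridPoint L (2 * (2 * M)))) ((p', σ'.rev), 1)))))) •
            (gen ℂ (((p', σ'), 0) : GridLeg (GridPoint L (2 * (2 * M)))) * gen ℂ (((q', σ'), 1) : GridLeg (GridPoint L (2 * (2 * M))))))) (omega0 M, pp) σσ).re +
        (selfEnergy L M β (ExteriorAlgebra.map (Matrix.toLin' (gridSubMatrix L M β
            (fun p : GridPoint L (2 * (2 * M)) => p.2) (fun p => gridTime β (2 * (2 * M)) p.1)))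
          (∑ p' : GridPoint L (2 * (2 * M)), ∑ q' : GridPoint L (2 * (2 * M)), ∑ σ' : Fin 2,
          (if p' = q' then (0 : ℂ) else
            -((((U * (β / (2 * (2 * M) : ℕ)) : ℝ) : ℂ) ^ 2 *
              (contr ℂ ((hubbardGridSub L M β (2 * (2 * M))).transpose * hubbardCovAboveCT L M β μ 0 0 klE0 *
                  hubbardGridSub L M β (2 * (2 * M))) (((q', σ'), 0) : GridLeg (GridPoint L (2 * (2 * M)))) ((p', σ'), 1) *
                (contr ℂ ((hubbardGridSub L M β (2 * (2 * M))).transpose * hubbardCovAboveCT L M β μ 0 0 klE0 *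
                    hubbardGridSub L M β (2 * (2 * M))) (((p', σ'.rev), 0) : GridLeg (GridPoint L (2 * (2 * M)))) ((q', σ'.rev), 1) *
                  contr ℂ ((hubbardGridSub L M β (2 * (2 * M))).transpose * hubbardCovAboveCT L M β μ 0 0 klE0 *
                    hubbardGridSub L M β (2 * (2 * M))) (((q', σ'.rev), 0) : GridLeg (GridPoint L (2 * (2 * M)))) ((p', σ'.rev), 1)))))) •
            (gen ℂ (((p', σ'), 0) : GridLeg (GridPoint L (2 * (2 * M)))) * gen ℂ (((q', σ'), 1) : GridLeg (GridPoint L (2 * (2 * M))))))) ((omega0 M).rev, pp) σσ).re)) / 4))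
        (WithLp.toLp 2 (klFermiPoint μ 0 θ))) θ| ≤ sS k * U ^ 2)
    (hD : ∀ θ : ℝ, ∀ i, 1 ≤ i → i ≤ 4 → ‖iteratedDeriv i (fun θ : ℝ => (WithLp.toLp 2 (klFermiPoint μ 0 θ) : Momentum)) θ‖ ≤ D i) :
    TwoLegReadJetBound L M
        (fun k => if k = 0 then 2 * (((2 : ℝ) ^ 13 * Real.exp 1 ^ 27 * (46 : ℝ) ^ 3 * ((10 : ℝ) ^ 95) ^ 2) * klTailBookU ^ 2) + 4
          else if k = 1 then 2 * ((2 : ℝ) ^ 1 * ((2 : ℝ) ^ 13 * Real.exp 1 ^ 27 * (46 : ℝ) ^ 3 * ((10 : ℝ) ^ 95) ^ 2) * klTailBookU) * D 1 + ((fun k : ℕ => if k = 0 then 16 * 16 * klScaleZeroA0 else bS k) 1 * D 1 + bell4 (fun _ : ℕ => (10 : ℝ) ^ 98 * U ^ 8) D 1)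
          else if k = 2 then 2 * ((2 : ℝ) ^ 2 * ((2 : ℝ) ^ 13 * Real.exp 1 ^ 27 * (46 : ℝ) ^ 3 * ((10 : ℝ) ^ 95) ^ 2) * klTailBookU) * D 1 ^ 2 + 2 * ((2 : ℝ) ^ 1 * ((2 : ℝ) ^ 13 * Real.exp 1 ^ 27 * (46 : ℝ) ^ 3 * ((10 : ℝ) ^ 95) ^ 2) * klTailBookU) * D 2 +
            ((fun k : ℕ => if k = 0 then 16 * 16 * klScaleZeroA0 else bS k) 2 * D 1 ^ 2 + (fun k : ℕ => if k = 0 then 16 * 16 * klScaleZeroA0 else bS k) 1 * D 2 + bell4 (fun _ : ℕ => (10 : ℝ) ^ 98 * U ^ 8) D 2)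
          else if k = 3 then 2 * ((2 : ℝ) ^ 3 * ((2 : ℝ) ^ 13 * Real.exp 1 ^ 27 * (46 : ℝ) ^ 3 * ((10 : ℝ) ^ 95) ^ 2) * klTailBookU) * D 1 ^ 3 + 3 * (2 * ((2 : ℝ) ^ 2 * ((2 : ℝ) ^ 13 * Real.exp 1 ^ 27 * (46 : ℝ) ^ 3 * ((10 : ℝ) ^ 95) ^ 2) * klTailBookU)) * D 1 * D 2 + 2 * ((2 : ℝ) ^ 1 * ((2 : ℝ) ^ 13 * Real.exp 1 ^ 27 * (46 : ℝ) ^ 3 * ((10 : ℝ) ^ 95) ^ 2) * klTailBookU) * D 3 +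
            (sS 3 + bell4 (fun _ : ℕ => (10 : ℝ) ^ 98 * U ^ 8) D 3)
          else if k = 4 then 2 * ((2 : ℝ) ^ 4 * ((2 : ℝ) ^ 13 * Real.exp 1 ^ 27 * (46 : ℝ) ^ 3 * ((10 : ℝ) ^ 95) ^ 2) * klTailBookU) * D 1 ^ 4 + 6 * (2 * ((2 : ℝ) ^ 3 * ((2 : ℝ) ^ 13 * Real.exp 1 ^ 27 * (46 : ℝ) ^ 3 * ((10 : ℝ) ^ 95) ^ 2) * klTailBookU)) * D 1 ^ 2 * D 2 + 3 * (2 * ((2 : ℝ) ^ 2 * ((2 : ℝ) ^ 13 * Real.exp 1 ^ 27 * (46 : ℝ) ^ 3 * ((10 : ℝ) ^ 95) ^ 2) * klTailBookU)) * D 2 ^ 2 +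
            4 * (2 * ((2 : ℝ) ^ 2 * ((2 : ℝ) ^ 13 * Real.exp 1 ^ 27 * (46 : ℝ) ^ 3 * ((10 : ℝ) ^ 95) ^ 2) * klTailBookU)) * D 1 * D 3 + 2 * ((2 : ℝ) ^ 1 * ((2 : ℝ) ^ 13 * Real.exp 1 ^ 27 * (46 : ℝ) ^ 3 * ((10 : ℝ) ^ 95) ^ 2) * klTailBookU) * D 4 + (sS 4 + bell4 (fun _ : ℕ => (10 : ℝ) ^ 98 * U ^ 8) D 4)
          else 0)
        (fun k => if k = 0 then 2 * ((2 : ℝ) ^ 0 * ((2 : ℝ) ^ 13 * Real.exp 1 ^ 27 * (46 : ℝ) ^ 3 * ((10 : ℝ) ^ 95) ^ 2) * klTailBookU) + (16 * 16 * klScaleZeroA0 + (fun _ : ℕ => (10 : ℝ) ^ 98 * U ^ 8) 0 + 2048 + 64 * (β / ((2 * (2 * M) : ℕ) : ℝ))) else 0) β U μ (klFlowFrameU L M β U μ 0) 0 ∧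
      TwoLegReadOscAt L M (4 * ((2 : ℝ) ^ 0 * ((2 : ℝ) ^ 13 * Real.exp 1 ^ 27 * (46 : ℝ) ^ 3 * ((10 : ℝ) ^ 95) ^ 2) * klTailBookU) + 2 * ((fun k : ℕ => if k = 0 then 16 * 16 * klScaleZeroA0 else bS k) 0 + (fun _ : ℕ => (10 : ℝ) ^ 98 * U ^ 8) 0)) β U μ (klFlowFrameU L M β U μ 0) 0 := by
  obtain ⟨-, -, -, -, hβ3M, -⟩ := scaleZero_regime_sizes (U := U) hβ hL hM
  have hUb' := klTailBookU_le_inv_ten_pow_103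
  -- free-curve regularity
  obtain ⟨-, hγ, -⟩ := freeFermiPointLp_C4 (μ := μ) hμ
  -- the tail rows (p1 g21 «A-SIZES-WEIGHTED» numerals at `Ub := klTailBookU`)
  have hTon :  ∀ (σ : Fin 2) (p₀ : GridPoint L (2 * (2 * M))), ∑ p₁ : GridPoint L (2 * (2 * M)),
      (if p₁.2 - p₀.2 = 0 then (1 : ℝ) else 0) * ‖kernel ℂ (effAction ℂ ((hubbardGridSub L M β (2 * (2 * M))).transpose * hubbardCovAboveCT L M β μ 0 0 klE0 *
            hubbardGridSub L M β (2 * (2 * M))) (hubbardGridInteraction L (2 * (2 * M)) β U) -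
          gaussConv ℂ ((hubbardGridSub L M β (2 * (2 * M))).transpose * hubbardCovAboveCT L M β μ 0 0 klE0 *
            hubbardGridSub L M β (2 * (2 * M))) (hubbardGridInteraction L (2 * (2 * M)) β U) +
        (2 : ℂ)⁻¹ • (gaussConv ℂ ((hubbardGridSub L M β (2 * (2 * M))).transpose * hubbardCovAboveCT L M β μ 0 0 klE0 *
              hubbardGridSub L M β (2 * (2 * M))) (hubbardGridInteraction L (2 * (2 * M)) β U * hubbardGridInteraction L (2 * (2 * M)) β U) -
          gaussConv ℂ ((hubbardGridSub L M β (2 * (2 * M))).transpose * hubbardCovAboveCT L M β μ 0 0 klE0 *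
              hubbardGridSub L M β (2 * (2 * M))) (hubbardGridInteraction L (2 * (2 * M)) β U) *
            gaussConv ℂ ((hubbardGridSub L M β (2 * (2 * M))).transpose * hubbardCovAboveCT L M β μ 0 0 klE0 *
              hubbardGridSub L M β (2 * (2 * M))) (hubbardGridInteraction L (2 * (2 * M)) β U))) 2 (fun i => ((![p₀, p₁] i, σ), i))‖ ≤ (((2 : ℝ) ^ 13 * Real.exp 1 ^ 27 * (46 : ℝ) ^ 3 * ((10 : ℝ) ^ 95) ^ 2) * klTailBookU ^ 2) * |U| * (β / ((2 * (2 * M) : ℕ) : ℝ)) := fun σ p₀ =>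
    twoLeg_wsum_tail3_frameZero_le_booked_numeral (L := L) (M := M) hμ hU hUb hUb' hβ hL hM
      (fun p₀ p₁ : GridPoint L (2 * (2 * M)) => if p₁.2 - p₀.2 = 0 then (1 : ℝ) else 0)
      (fun p q => by split_ifs <;> norm_num) (fun p q => by split_ifs <;> norm_num) σ p₀
  have hToff :  ∀ k ≤ 4, ∀ (σ : Fin 2) (p₀ : GridPoint L (2 * (2 * M))), ∑ p₁ : GridPoint L (2 * (2 * M)),
      (if p₁.2 - p₀.2 = 0 then (0 : ℝ) else
        (1 + (((p₁.2 - p₀.2) 0).valMinAbs.natAbs : ℝ) + (((p₁.2 - p₀.2) 1).valMinAbs.natAbs : ℝ)) ^ k) *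
        ‖kernel ℂ (effAction ℂ ((hubbardGridSub L M β (2 * (2 * M))).transpose * hubbardCovAboveCT L M β μ 0 0 klE0 *
            hubbardGridSub L M β (2 * (2 * M))) (hubbardGridInteraction L (2 * (2 * M)) β U) -
          gaussConv ℂ ((hubbardGridSub L M β (2 * (2 * M))).transpose * hubbardCovAboveCT L M β μ 0 0 klE0 *
            hubbardGridSub L M β (2 * (2 * M))) (hubbardGridInteraction L (2 * (2 * M)) β U) +
        (2 : ℂ)⁻¹ • (gaussConv ℂ ((hubbardGridSub L M β (2 * (2 * M))).transpose * hubbardCovAboveCT L M β μ 0 0 klE0 *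
              hubbardGridSub L M β (2 * (2 * M))) (hubbardGridInteraction L (2 * (2 * M)) β U * hubbardGridInteraction L (2 * (2 * M)) β U) -
          gaussConv ℂ ((hubbardGridSub L M β (2 * (2 * M))).transpose * hubbardCovAboveCT L M β μ 0 0 klE0 *
              hubbardGridSub L M β (2 * (2 * M))) (hubbardGridInteraction L (2 * (2 * M)) β U) *
            gaussConv ℂ ((hubbardGridSub L M β (2 * (2 * M))).transpose * hubbardCovAboveCT L M β μ 0 0 klE0 *
              hubbardGridSub L M β (2 * (2 * M))) (hubbardGridInteraction L (2 * (2 * M)) β U))) 2 (fun i => ((![p₀, p₁] i, σ), i))‖ ≤ ((2 : ℝ) ^ k * ((2 : ℝ) ^ 13 * Real.exp 1 ^ 27 * (46 : ℝ) ^ 3 * ((10 : ℝ) ^ 95) ^ 2) * klTailBookU) * U ^ 2 * (β / ((2 * (2 * M) : ℕ) : ℝ)) := fun k hk σ p₀ =>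
    twoLeg_offDiag_moment_pow_sum_tail3_frameZero_le_booked_numeral (L := L) (M := M) hμ hU hUb hUb' hβ hL hM hk σ p₀
  -- the plain sunset column (bare frame, `R₀ = 0`)
  have hRW : (⟨0, 0, fun _ => 0⟩ : RenConsts).WF := ⟨le_rfl, le_rfl, fun _ => le_rfl⟩
  have hK0 : FrameOK (⟨0, 0, fun _ => 0⟩ : RenConsts) U 0 μ 0 := klFrameOK_zeroC hRW U 0 hμ
  have hcol : ∀ Y, ∑ X, ‖((hubbardGridSub L M β (2 * (2 * M))).transpose * hubbardCovAboveCT L M β μ 0 0 klE0 *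
        hubbardGridSub L M β (2 * (2 * M))) X Y‖ ≤ klScaleZeroA0 * ((2 * (2 * M) : ℕ) : ℝ) / β := fun Y =>
    (colSum_scaleZero_le_A0 (L := L) hK0 hβ hβ3M Y).trans (le_of_eq (by ring))
  have hSall :  ∀ (σ : Fin 2) (p₀ : GridPoint L (2 * (2 * M))), ∑ p₁ : GridPoint L (2 * (2 * M)),
      (if p₁ = p₀ then (0 : ℝ) else (1 : ℝ) * ‖contr ℂ ((hubbardGridSub L M β (2 * (2 * M))).transpose * hubbardCovAboveCT L M β μ 0 0 klE0 *
                hubbardGridSub L M β (2 * (2 * M))) (((p₁, σ), 0) : GridLeg (GridPoint L (2 * (2 * M)))) ((p₀, σ), 1) *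
              (contr ℂ ((hubbardGridSub L M β (2 * (2 * M))).transpose * hubbardCovAboveCT L M β μ 0 0 klE0 *
                hubbardGridSub L M β (2 * (2 * M))) (((p₀, σ.rev), 0) : GridLeg (GridPoint L (2 * (2 * M)))) ((p₁, σ.rev), 1) *
                contr ℂ ((hubbardGridSub L M β (2 * (2 * M))).transpose * hubbardCovAboveCT L M β μ 0 0 klE0 *
                hubbardGridSub L M β (2 * (2 * M))) (((p₁, σ.rev), 0) : GridLeg (GridPoint L (2 * (2 * M)))) ((p₀, σ.rev), 1))‖) ≤ (16 * 16 * klScaleZeroA0) * (((2 * (2 * M) : ℕ) : ℝ) / β) := fun σ p₀ =>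
    sunset_plainSum_le_of_col (L := L) (M := M) (U := U) hμ hβ hL hcol σ p₀
  have hS0 :  ∀ (σ : Fin 2) (p₀ : GridPoint L (2 * (2 * M))), ∑ p₁ : GridPoint L (2 * (2 * M)),
      (if p₁ = p₀ then (0 : ℝ) else (if p₁.2 - p₀.2 = 0 then (0 : ℝ) else 1) * ‖contr ℂ ((hubbardGridSub L M β (2 * (2 * M))).transpose * hubbardCovAboveCT L M β μ 0 0 klE0 *
                hubbardGridSub L M β (2 * (2 * M))) (((p₁, σ), 0) : GridLeg (GridPoint L (2 * (2 * M)))) ((p₀, σ), 1) *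
              (contr ℂ ((hubbardGridSub L M β (2 * (2 * M))).transpose * hubbardCovAboveCT L M β μ 0 0 klE0 *
                hubbardGridSub L M β (2 * (2 * M))) (((p₀, σ.rev), 0) : GridLeg (GridPoint L (2 * (2 * M)))) ((p₁, σ.rev), 1) *
                contr ℂ ((hubbardGridSub L M β (2 * (2 * M))).transpose * hubbardCovAboveCT L M β μ 0 0 klE0 *
                hubbardGridSub L M β (2 * (2 * M))) (((p₁, σ.rev), 0) : GridLeg (GridPoint L (2 * (2 * M)))) ((p₀, σ.rev), 1))‖) ≤ (fun k : ℕ => if k = 0 then 16 * 16 * klScaleZeroA0 else bS k) 0 * (((2 * (2 * M) : ℕ) : ℝ) / β) := fun σ p₀ =>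
    le_of_le_of_eq ((sunset_offSiteSum_le_plainSum (L := L) (M := M) β μ σ p₀).trans (hSall σ p₀)) (by simp only [if_true])
  have hSk :  ∀ k, 1 ≤ k → k ≤ 2 → ∀ (σ : Fin 2) (p₀ : GridPoint L (2 * (2 * M))), ∑ p₁ : GridPoint L (2 * (2 * M)),
      (if p₁ = p₀ then (0 : ℝ) else
        Real.sqrt ((((p₁.2 - p₀.2) 0).valMinAbs.natAbs : ℝ) ^ 2 + (((p₁.2 - p₀.2) 1).valMinAbs.natAbs : ℝ) ^ 2) ^ k * ‖contr ℂ ((hubbardGridSub L M β (2 * (2 * M))).transpose * hubbardCovAboveCT L M β μ 0 0 klE0 *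
                hubbardGridSub L M β (2 * (2 * M))) (((p₁, σ), 0) : GridLeg (GridPoint L (2 * (2 * M)))) ((p₀, σ), 1) *
              (contr ℂ ((hubbardGridSub L M β (2 * (2 * M))).transpose * hubbardCovAboveCT L M β μ 0 0 klE0 *
                hubbardGridSub L M β (2 * (2 * M))) (((p₀, σ.rev), 0) : GridLeg (GridPoint L (2 * (2 * M)))) ((p₁, σ.rev), 1) *
                contr ℂ ((hubbardGridSub L M β (2 * (2 * M))).transpose * hubbardCovAboveCT L M β μ 0 0 klE0 *
                hubbardGridSub L M β (2 * (2 * M))) (((p₁, σ.rev), 0) : GridLeg (GridPoint L (2 * (2 * M)))) ((p₀, σ.rev), 1))‖) ≤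
        (fun k : ℕ => if k = 0 then 16 * 16 * klScaleZeroA0 else bS k) k * (((2 * (2 * M) : ℕ) : ℝ) / β) := fun k hk1 hk2 σ p₀ =>
    le_of_le_of_eq (hS12 k hk1 hk2 σ p₀) (by simp only [show k ≠ 0 by omega, if_false])
  -- the chain's aliasing table `a j := 10⁹⁸·U⁸`
  have hA := fun j (hj : j ≤ 4) => alias_le_of_le_four (L := L) (M := M) (U := U) hβ hU hL μ hj
  exact twoLegRead_frameZero_of_sunsetData (L := L) (M := M) (Mdeg := 12) hβ hμ (by norm_num)
    (tv := ((2 : ℝ) ^ 13 * Real.exp 1 ^ 27 * (46 : ℝ) ^ 3 * ((10 : ℝ) ^ 95) ^ 2) * klTailBookU ^ 2) (tb := fun k => (2 : ℝ) ^ k * ((2 : ℝ) ^ 13 * Real.exp 1 ^ 27 * (46 : ℝ) ^ 3 * ((10 : ℝ) ^ 95) ^ 2) * klTailBookU)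
    (bSA := 16 * 16 * klScaleZeroA0) (bS := fun k : ℕ => if k = 0 then 16 * 16 * klScaleZeroA0 else bS k) (sS := sS) (D := D)
    (a := fun _ : ℕ => (10 : ℝ) ^ 98 * U ^ 8) hTon hToff hSall hS0 hSk hγ hD hSjet hA

end Raw

end Summit.HubbardSuperconductivity.HubbardSuperconductivity.Theorems.KLRegimeSplit

end
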